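import Literature.NumberTheory.Irrationality.PAdicZetaValues.HurwitzLemma27Proofs
import Mathlib.Analysis.Calculus.Deriv.ZPow
import Mathlib.Analysis.Calculus.Deriv.Slope
import HarnessLib

/-!
# Lai–Sprang–Zudilin 2026, §2.2–§2.3: the Lipschitz ("`Δ`-operator") estimate of Volkenborn integrals,
# the translation formula, and the half-shifted integrals `(1/(s−1))∫_{ℤ₂}(t+½)^{1−s}dt = 2^s ζ₂(s)` — PROVED

Topic `Literature/NumberTheory/Irrationality/PAdicZetaValues`.  Source: L. Lai, J. Sprang, W. Zudilin, *A note on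
the irrationality of `ζ₂(5)`*, IMRN **2026**:16, rnag180 = arXiv:2505.05005 [LaiSprangZudilin2026], §2.2
"Volkenborn integrals" and §2.3 "`p`-adic zeta values" (held text `paper:arxiv-2505.05005`, chunks p0004–p0005, read
on the page).  PROOF FILE: theorems and two auxiliary predicates with bodies; no named fact, net debt 0.  It is
the preliminary layer for the tree's discharge of [LaiSprangZudilin2026, Thm 1.1] (`ζ₂(5) ∉ ℚ`).

## Source, as printed, and what is formalised

* §2.2: "A function `f : ℤ_p → ℚ_p` is said to be Volkenborn integrable if the sequence `p^{−n} Σ_{k=0}^{p^n−1} f(k)`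
  converges … **Lemma 2.4** ([Rob2000]).  Let `f ∈ S¹(ℤ_p,ℚ_p)`.  Then, for any `k ∈ ℤ_{>0}`,
  `∫_{ℤ_p} f(t+k) dt = ∫_{ℤ_p} f(t) dt + Σ_{ℓ=0}^{k−1} f′(ℓ)`."  — PROVED as `tendsto_volkenbornSum_shift_nat`
  (for the Riemann sums of the tree's `LocalFields.volkenbornSum`, the derivative entering only through the limits
  `p^{−n}(f(p^n+ℓ) − f(ℓ)) → f′(ℓ)`, exactly as in Robert's `∫∇f = f′(0)` = tree `tendsto_volkenbornSum_fwdDiff`).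
* §2.2: the characteristic `Δ(f) := min{ inf_{k≥1} v_p((f(k) − f(k_−))/(k − k_−)), 1 + v_p(f(0)) }` ("first introduced by
  the second author in [Spr2020] and further developed by the first author in [Lai2025]"), **Lemma 2.5**
  ("`v_p(∫_{ℤ_p} f(t)dt) ≥ Δ(f) − 1`") and **Lemma 2.6** ((a) `Δ(f+g) ≥ min`, (b) `Δ(C·f) = Δ(f)+v_p(C)`, (c) for
  `ℤ_p`-valued `f, g`: `Δ(fg) ≥ min{Δ(f),Δ(g)}`, (e) `Δ(binom(t+j, n)) ≥ −⌊log n/log p⌋`).  FORMALISED IN LIPSCHITZ FORM on the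
  values at the natural numbers (the only values the Riemann sums see): `LipNat p M g` says
  `‖g(k+h) − g(k)‖_p ≤ M·‖h‖_p` for all `k, h ∈ ℕ` (this implies `v_p((g(k)−g(k_−))/(k−k_−)) ≥ −log_p M`, i.e. it is the
  difference-quotient clause of `Δ` quantified over ALL pairs rather than over the digit-deletion pairs `(k, k_−)`);
  `BddNat p g` says `‖g(k)‖_p ≤ 1` ("`ℤ_p`-valued").  PROVED: the closure rules (a) `LipNat.add`, (b) `LipNat.const_mul`,
  (c) `LipNat.mul` (+ `pow`, `finset_prod`, `finset_sum`), (e) `lipNat_choose` (`‖binom(k+h+c,r) − binom(k+c,r)‖_p ≤ p^{⌊log_p r⌋}‖h‖_p`,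
  by Vandermonde's convolution and `binom(h,j) = (h/j)·binom(h−1,j−1)`), and **Lemma 2.5 in Riemann-sum form**:
  `norm_volkenbornSum_le_of_lipNat` — `‖p^{−n}Σ_{k<p^n} f(k)‖_p ≤ max(‖f(0)‖_p, p·M)` for EVERY `n` (so the Volkenborn
  integral, when it exists, obeys the same bound: `norm_le_of_tendsto_volkenbornSum_of_lipNat`).  The proof is Robert's one-step estimate
  `‖S_{n+1} − S_n‖ ≤ pM` (tree `LocalFields.volkenbornSum_succ_sub`), i.e. the digit-peeling induction of [Lai2025].
  (Part (d) of Lemma 2.6 — power series with `ℤ_p`-coefficients tending to `0` — is not needed in this form: the only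
  such functions met in [LaiSprangZudilin2026, §6] are finite products of `(2t+2j+1)^{−1}`, covered by `lipNat_inv_linear`.)
* §2.3, (2.1) and **Lemma 2.8**: "`ζ₂(s) = ¼(ω(1)^{1−s}ζ₂(s,¼) + ω(3)^{1−s}ζ₂(s,¾)) = … =
  (1/(4(s−1)))(lim_N 2^{−N}Σ_{k<2^N}(1+4k)^{1−s} + lim_N 2^{−N}Σ_{k<2^N}(3+4k)^{1−s})`" and "**Lemma 2.8.** For any
  `s ∈ ℤ_{≥2}` we have `(1/(s−1))∫_{ℤ₂} dt/(t+½)^{s−1} = 2^s·ζ₂(s)`.  *Proof.* … `= (2^{s−1}/(s−1)) lim_N 2^{−(N+1)}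
  (Σ_{k<2^N}(1+4k)^{1−s} + Σ_{k<2^N}(3+4k)^{1−s})`."  — PROVED as `tendsto_volkenbornSum_half_zpow_neg`:
  for `m ≥ 1` the Riemann sums of `(t+½)^{−m}` tend to `m·2^{m+1}·ζ₂(m+1)` (`s = m+1`), with `ζ₂` the TREE's
  `padicZetaValue 2` (Basic.lean); the display (2.1) is the tree's `padicZetaValue_eq_sum_unitClasses` at `p = 2`,
  `q₂ = 4` (HurwitzLemma27Proofs.lean), the parity split is the tree's `volkenbornSum_add_eq_sum_residues`, and the
  existence of all limits is the tree's `tendsto_riemannSum_zpow_neg` (HurwitzVolkenbornProofs.lean).  For even `s`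
  the right-hand side is `0` by the tree's `padicZetaValue_even`, as the source notes ("`ζ_p(s) = 0` for any even
  positive integer `s`").

Cell zeta5-irr / pub-zeta5 (HONEST FRAMING: systematic search; no irrationality claim unless kernel-certified):
`2`-adic preliminaries; nothing here bears on `ζ(5) ∈ ℝ`.
-/

noncomputable section

open Filter Finset
open scoped Topology

namespace Literature.NumberTheory.Irrationality.PAdicZetaValues

open Literature.NumberTheory.LocalFields

variable {p : ℕ} [hp : Fact p.Prime]

/-! ## §1. The Lipschitz predicate on the values at the naturals (the difference-quotient clause of `Δ`) -/

/-- **The Lipschitz clause of `Δ`** (values at the naturals): `‖g(k+h) − g(k)‖_p ≤ M‖h‖_p` for all `k, h ∈ ℕ`;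
`Δ(g) ≥ −log_p M` for the difference quotients of [LaiSprangZudilin2026, §2.2]. [cite: LaiSprangZudilin2026, §2.2 (definition of `Δ`)] -/
def LipNat (p : ℕ) [Fact p.Prime] (M : ℝ) (g : ℕ → ℚ_[p]) : Prop :=
  ∀ k h : ℕ, ‖g (k + h) - g k‖ ≤ M * ‖(h : ℚ_[p])‖

/-- "`ℤ_p`-valued" on the naturals: `‖g(k)‖_p ≤ 1`. [cite: LaiSprangZudilin2026, Lemma 2.6 (c) (hypothesis `f, g ∈ S¹(ℤ_p, ℤ_p)`)] -/
def BddNat (p : ℕ) [Fact p.Prime] (g : ℕ → ℚ_[p]) : Prop :=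
  ∀ k : ℕ, ‖g k‖ ≤ 1

omit hp in
/-- `‖m‖_p ≤ 1` for a natural number `m`. [folklore] -/
private theorem norm_natCast_le_one' [Fact p.Prime] (m : ℕ) : ‖(m : ℚ_[p])‖ ≤ 1 := by
  have h := Padic.norm_int_le_one (p := p) (m : ℤ)
  rwa [Int.cast_natCast] at h

namespace LipNat

variable {M M' : ℝ} {f g : ℕ → ℚ_[p]}

/-- Monotonicity in the constant. [cite: LaiSprangZudilin2026, §2.2 (definition of `Δ`)] -/
theorem mono (hf : LipNat p M f) (hMM' : M ≤ M') : LipNat p M' f :=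
  fun k h => (hf k h).trans (mul_le_mul_of_nonneg_right hMM' (norm_nonneg _))

/-- Constants: `Δ = +∞` on the difference quotients. [cite: LaiSprangZudilin2026, Lemma 2.6 (b)] -/
theorem const (c : ℚ_[p]) : LipNat p 0 (fun _ => c) := fun k h => by simp

/-- **Lemma 2.6 (a):** `Δ(f+g) ≥ min{Δ(f), Δ(g)}` — Lipschitz form (ultrametric). [cite: LaiSprangZudilin2026, Lemma 2.6 (a)] -/
theorem add (hf : LipNat p M f) (hg : LipNat p M' g) : LipNat p (max M M') (fun k => f k + g k) := by
  intro k h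
  have e : f (k + h) + g (k + h) - (f k + g k) = (f (k + h) - f k) + (g (k + h) - g k) := by ring
  rw [e]
  refine (IsUltrametricDist.norm_add_le_max _ _).trans (max_le ?_ ?_)
  · exact (hf k h).trans (mul_le_mul_of_nonneg_right (le_max_left _ _) (norm_nonneg _))
  · exact (hg k h).trans (mul_le_mul_of_nonneg_right (le_max_right _ _) (norm_nonneg _))

/-- Negation. [cite: LaiSprangZudilin2026, Lemma 2.6 (b) (`C = −1`)] -/
theorem neg (hf : LipNat p M f) : LipNat p M (fun k => -f k) := by
  intro k h
  rw [show -f (k + h) - -f k = -(f (k + h) - f k) by ring, norm_neg]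
  exact hf k h

/-- Subtraction. [cite: LaiSprangZudilin2026, Lemma 2.6 (a), (b)] -/
theorem sub (hf : LipNat p M f) (hg : LipNat p M' g) : LipNat p (max M M') (fun k => f k - g k) := by
  simpa [sub_eq_add_neg] using hf.add hg.neg

/-- **Lemma 2.6 (b):** `Δ(C·f) = Δ(f) + v_p(C)` — Lipschitz form: the constant is multiplied by `‖C‖_p`.
[cite: LaiSprangZudilin2026, Lemma 2.6 (b)] -/
theorem const_mul (hf : LipNat p M f) (c : ℚ_[p]) : LipNat p (‖c‖ * M) (fun k => c * f k) := by
  intro k h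
  rw [← mul_sub, norm_mul, mul_assoc]
  exact mul_le_mul_of_nonneg_left (hf k h) (norm_nonneg _)

/-- **Lemma 2.6 (c):** for `ℤ_p`-valued `f, g`: `Δ(fg) ≥ min{Δ(f), Δ(g)}` — Lipschitz form, from
`f(y)g(y) − f(x)g(x) = f(y)(g(y) − g(x)) + g(x)(f(y) − f(x))`. [cite: LaiSprangZudilin2026, Lemma 2.6 (c)] -/
theorem mul (hf : LipNat p M f) (hg : LipNat p M' g) (hfb : BddNat p f) (hgb : BddNat p g) :
    LipNat p (max M M') (fun k => f k * g k) := by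
  intro k h
  have e : f (k + h) * g (k + h) - f k * g k = f (k + h) * (g (k + h) - g k) + g k * (f (k + h) - f k) := by ring
  rw [e]
  refine (IsUltrametricDist.norm_add_le_max _ _).trans (max_le ?_ ?_)
  · rw [norm_mul]
    calc ‖f (k + h)‖ * ‖g (k + h) - g k‖ ≤ 1 * (M' * ‖(h : ℚ_[p])‖) :=
          mul_le_mul (hfb _) (hg k h) (norm_nonneg _) zero_le_one
      _ ≤ max M M' * ‖(h : ℚ_[p])‖ := by
          rw [one_mul]; exact mul_le_mul_of_nonneg_right (le_max_right _ _) (norm_nonneg _)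
  · rw [norm_mul]
    calc ‖g k‖ * ‖f (k + h) - f k‖ ≤ 1 * (M * ‖(h : ℚ_[p])‖) :=
          mul_le_mul (hgb _) (hf k h) (norm_nonneg _) zero_le_one
      _ ≤ max M M' * ‖(h : ℚ_[p])‖ := by
          rw [one_mul]; exact mul_le_mul_of_nonneg_right (le_max_left _ _) (norm_nonneg _)

/-- Products with the same constant. [cite: LaiSprangZudilin2026, Lemma 2.6 (c)] -/
theorem mul' (hf : LipNat p M f) (hg : LipNat p M g) (hfb : BddNat p f) (hgb : BddNat p g) :
    LipNat p M (fun k => f k * g k) := by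
  simpa using hf.mul hg hfb hgb

/-- Powers of a `ℤ_p`-valued function. [cite: LaiSprangZudilin2026, Lemma 2.6 (c)] -/
theorem pow (hf : LipNat p M f) (hfb : BddNat p f) (hM : 0 ≤ M) (n : ℕ) : LipNat p M (fun k => f k ^ n) := by
  induction n with
  | zero => simpa using (LipNat.const (p := p) 1).mono hM
  | succ n ih =>
    have hb : BddNat p (fun k => f k ^ n) := fun k => by
      rw [norm_pow]; exact pow_le_one₀ (norm_nonneg _) (hfb k)
    simpa [pow_succ] using ih.mul' hf hb hfb

/-- Finite sums (all with the same constant). [cite: LaiSprangZudilin2026, Lemma 2.6 (a)] -/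
theorem finset_sum {ι : Type*} (s : Finset ι) {F : ι → ℕ → ℚ_[p]} (hM : 0 ≤ M)
    (h : ∀ i ∈ s, LipNat p M (F i)) : LipNat p M (fun k => ∑ i ∈ s, F i k) := by
  classical
  induction s using Finset.induction_on with
  | empty => simpa using (LipNat.const (p := p) 0).mono hM
  | insert a s ha ih =>
    have h1 : LipNat p M (F a) := h a (mem_insert_self _ _)
    have h2 := ih fun i hi => h i (mem_insert_of_mem hi)
    simpa [Finset.sum_insert ha] using h1.add h2

/-- Finite products of `ℤ_p`-valued functions (all with the same constant). [cite: LaiSprangZudilin2026, Lemma 2.6 (c)] -/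
theorem finset_prod {ι : Type*} (s : Finset ι) {F : ι → ℕ → ℚ_[p]} (hM : 0 ≤ M)
    (h : ∀ i ∈ s, LipNat p M (F i)) (hb : ∀ i ∈ s, BddNat p (F i)) :
    LipNat p M (fun k => ∏ i ∈ s, F i k) := by
  classical
  induction s using Finset.induction_on with
  | empty => simpa using (LipNat.const (p := p) 1).mono hM
  | insert a s ha ih =>
    have h1 : LipNat p M (F a) := h a (mem_insert_self _ _)
    have h2 := ih (fun i hi => h i (mem_insert_of_mem hi)) fun i hi => hb i (mem_insert_of_mem hi)
    have hb2 : BddNat p (fun k => ∏ i ∈ s, F i k) := fun k => by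
      rw [norm_prod]
      exact prod_le_one (fun i _ => norm_nonneg _) fun i hi => hb i (mem_insert_of_mem hi) k
    simpa [Finset.prod_insert ha] using h1.mul' h2 (hb a (mem_insert_self _ _)) hb2

end LipNat

namespace BddNat

variable {f g : ℕ → ℚ_[p]}

/-- Products of `ℤ_p`-valued functions. [cite: LaiSprangZudilin2026, Lemma 2.6 (c)] -/
theorem mul (hf : BddNat p f) (hg : BddNat p g) : BddNat p (fun k => f k * g k) := fun k => by
  rw [norm_mul]; exact mul_le_one₀ (hf k) (norm_nonneg _) (hg k)

/-- Powers. [cite: LaiSprangZudilin2026, Lemma 2.6 (c)] -/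
theorem pow (hf : BddNat p f) (n : ℕ) : BddNat p (fun k => f k ^ n) := fun k => by
  rw [norm_pow]; exact pow_le_one₀ (norm_nonneg _) (hf k)

/-- Finite products. [cite: LaiSprangZudilin2026, Lemma 2.6 (c)] -/
theorem finset_prod {ι : Type*} (s : Finset ι) {F : ι → ℕ → ℚ_[p]} (hb : ∀ i ∈ s, BddNat p (F i)) :
    BddNat p (fun k => ∏ i ∈ s, F i k) := fun k => by
  rw [norm_prod]; exact prod_le_one (fun i _ => norm_nonneg _) fun i hi => hb i hi k

/-- Natural-number-valued functions are `ℤ_p`-valued. [cite: LaiSprangZudilin2026, Lemma 2.6 (c) (`ℤ_p`-valued functions)] -/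
theorem natCast (u : ℕ → ℕ) : BddNat p (fun k => ((u k : ℕ) : ℚ_[p])) := fun k => norm_natCast_le_one' (u k)

end BddNat

/-! ## §2. The basic Lipschitz functions: linear polynomials, unit denominators, binomial coefficients -/

/-- A linear polynomial `a k + b` with `‖a‖_p ≤ 1`: Lipschitz constant `‖a‖_p`. [cite: LaiSprangZudilin2026, Lemma 2.6 (d) (polynomials over `ℤ_p`)] -/
theorem lipNat_linear (a b : ℚ_[p]) : LipNat p ‖a‖ (fun k => a * k + b) := by
  intro k h
  rw [show a * ((k + h : ℕ) : ℚ_[p]) + b - (a * k + b) = a * h by push_cast; ring, norm_mul]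

/-- A linear polynomial with `‖a‖_p, ‖b‖_p ≤ 1` is `ℤ_p`-valued. [cite: LaiSprangZudilin2026, Lemma 2.6 (d)] -/
theorem bddNat_linear {a b : ℚ_[p]} (ha : ‖a‖ ≤ 1) (hb : ‖b‖ ≤ 1) : BddNat p (fun k => a * k + b) := by
  intro k
  refine (IsUltrametricDist.norm_add_le_max _ _).trans (max_le ?_ hb)
  rw [norm_mul]
  exact mul_le_one₀ ha (norm_nonneg _) (norm_natCast_le_one' k)

/-- If `‖a‖_p < 1` and `‖b‖_p = 1` then `a k + b` is a `p`-adic unit for every `k ∈ ℕ` (the denominators `2t+2j+1` of the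
function `g(t)` of [LaiSprangZudilin2026, §6]). [cite: LaiSprangZudilin2026, Lemma 6.2 (proof, the function `g(t)`)] -/
theorem norm_linear_eq_one {a b : ℚ_[p]} (ha : ‖a‖ < 1) (hb : ‖b‖ = 1) (k : ℕ) : ‖a * k + b‖ = 1 := by
  have h1 : ‖a * (k : ℚ_[p])‖ < 1 := by
    rw [norm_mul]
    exact lt_of_le_of_lt (mul_le_of_le_one_right (norm_nonneg _) (norm_natCast_le_one' k)) ha
  have hne : ‖a * (k : ℚ_[p])‖ ≠ ‖b‖ := by rw [hb]; exact h1.ne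
  rw [Padic.add_eq_max_of_ne hne, hb, max_eq_right h1.le]

/-- **Unit denominators** (the factors `(2t+2j+1)^{−1}` of [LaiSprangZudilin2026, §6]): for `‖a‖_p < 1 = ‖b‖_p`,
`k ↦ (a k + b)^{−1}` is `ℤ_p`-valued and Lipschitz with constant `‖a‖_p`, since
`(ay+b)^{−1} − (ax+b)^{−1} = a(x−y)/((ax+b)(ay+b))`. [cite: LaiSprangZudilin2026, Lemma 2.6 (d) (the function `g(t)` of §6)] -/
theorem lipNat_inv_linear {a b : ℚ_[p]} (ha : ‖a‖ < 1) (hb : ‖b‖ = 1) : LipNat p ‖a‖ (fun k => (a * k + b)⁻¹) := by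
  intro k h
  have hu := norm_linear_eq_one ha hb k
  have hv := norm_linear_eq_one ha hb (k + h)
  have hu0 : a * (k : ℚ_[p]) + b ≠ 0 := norm_pos_iff.mp (by rw [hu]; exact one_pos)
  have hv0 : a * ((k + h : ℕ) : ℚ_[p]) + b ≠ 0 := norm_pos_iff.mp (by rw [hv]; exact one_pos)
  have e : (a * ((k + h : ℕ) : ℚ_[p]) + b)⁻¹ - (a * k + b)⁻¹ =
      -(a * h) / ((a * ((k + h : ℕ) : ℚ_[p]) + b) * (a * k + b)) := by
    field_simp
    push_cast
    ring
  rw [e, norm_div, norm_neg, norm_mul, norm_mul, hu, hv, mul_one, div_one]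

/-- Unit denominators are `ℤ_p`-valued. [cite: LaiSprangZudilin2026, Lemma 2.6 (d)] -/
theorem bddNat_inv_linear {a b : ℚ_[p]} (ha : ‖a‖ < 1) (hb : ‖b‖ = 1) : BddNat p (fun k => (a * k + b)⁻¹) := by
  intro k
  rw [norm_inv, norm_linear_eq_one ha hb k, inv_one]

/-- `binom(h, j+1) = h · binom(h−1, j)/(j+1)` in `ℚ_p` for every natural `h` (for `h = 0` both sides vanish) — the step that
produces the denominators `j ≤ n` in Lemma 2.6 (e). [cite: LaiSprangZudilin2026, Lemma 2.6 (e) (proof, after [Lai2025])] -/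
theorem cast_choose_succ_eq (h j : ℕ) :
    ((h.choose (j + 1) : ℕ) : ℚ_[p]) = (h : ℚ_[p]) * ((h - 1).choose j : ℕ) / ((j + 1 : ℕ) : ℚ_[p]) := by
  have hj : ((j + 1 : ℕ) : ℚ_[p]) ≠ 0 := by exact_mod_cast Nat.succ_ne_zero j
  rw [eq_div_iff hj]
  rcases Nat.eq_zero_or_pos h with rfl | hpos
  · simp [Nat.choose_eq_zero_of_lt (Nat.succ_pos j)]
  · obtain ⟨h', rfl⟩ : ∃ h', h = h' + 1 := ⟨h - 1, by omega⟩
    have key := Nat.add_one_mul_choose_eq h' j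
    rw [Nat.add_sub_cancel]
    have : ((h' + 1 : ℕ) : ℚ_[p]) * (h'.choose j : ℕ) = ((h' + 1).choose (j + 1) : ℕ) * ((j + 1 : ℕ) : ℚ_[p]) := by
      exact_mod_cast key
    rw [← this]

/-- `‖1/j‖_p ≤ p^{⌊log_p r⌋}` for `1 ≤ j ≤ r` (`p^{v_p(j)} ∣ j ≤ r`): the bound `−⌊log n/log p⌋` of Lemma 2.6 (e).
[cite: LaiSprangZudilin2026, Lemma 2.6 (e)] -/
theorem norm_inv_natCast_le_pow_log {j r : ℕ} (hj : 1 ≤ j) (hjr : j ≤ r) :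
    ‖((j : ℚ_[p]))⁻¹‖ ≤ (p : ℝ) ^ Nat.log p r := by
  have hj0 : (j : ℚ_[p]) ≠ 0 := by exact_mod_cast (show j ≠ 0 by omega)
  have hp1 : (1 : ℝ) ≤ p := by exact_mod_cast hp.out.one_lt.le
  rw [norm_inv]
  -- `‖j‖_p = p^{−v_p(j)}`
  have hnorm : ‖(j : ℚ_[p])‖ = (p : ℝ) ^ (-(padicValNat p j : ℤ)) := by
    have h := Padic.eq_padicNorm (p := p) (j : ℚ)
    rw [Rat.cast_natCast] at h
    rw [h, padicNorm.eq_zpow_of_nonzero (by exact_mod_cast (show j ≠ 0 by omega)), padicValRat.of_nat]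
    push_cast
    rfl
  rw [hnorm, ← zpow_neg, neg_neg, zpow_natCast]
  refine pow_le_pow_right₀ hp1 ?_
  -- `v_p(j) ≤ log_p j ≤ log_p r`
  have h1 : p ^ padicValNat p j ≤ j := Nat.le_of_dvd (by omega) pow_padicValNat_dvd
  calc padicValNat p j ≤ Nat.log p j := Nat.le_log_of_pow_le hp.out.one_lt h1
    _ ≤ Nat.log p r := Nat.log_mono_right hjr

/-- **Lemma 2.6 (e)** in Lipschitz form: for the binomial polynomial `f(t) = binom(t+c, r)` restricted to `ℕ`,
`‖f(k+h) − f(k)‖_p ≤ p^{⌊log_p r⌋}·‖h‖_p` ("`Δ(f) ≥ −⌊log n/log p⌋`"): by Vandermonde's convolution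
`binom(k+h+c, r) − binom(k+c, r) = Σ_{j=1}^{r} binom(k+c, r−j)·binom(h, j)` and `binom(h,j) = (h/j)binom(h−1,j−1)`.
[cite: LaiSprangZudilin2026, Lemma 2.6 (e)] -/
theorem lipNat_choose (c r : ℕ) :
    LipNat p ((p : ℝ) ^ Nat.log p r) (fun k => (((k + c).choose r : ℕ) : ℚ_[p])) := by
  intro k h
  change ‖(((k + h + c).choose r : ℕ) : ℚ_[p]) - (((k + c).choose r : ℕ) : ℚ_[p])‖ ≤ _
  -- Vandermonde: `binom(k+c+h, r) = Σ_{j ≤ r} binom(k+c, r−j) binom(h, j)`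
  have hV : (((k + h + c).choose r : ℕ) : ℚ_[p]) =
      ∑ j ∈ range (r + 1), (((k + c).choose (r - j) : ℕ) : ℚ_[p]) * ((h.choose j : ℕ) : ℚ_[p]) := by
    rw [show k + h + c = (k + c) + h by ring, Nat.add_choose_eq, Nat.sum_antidiagonal_eq_sum_range_succ
      (fun i j => ((k + c).choose i : ℕ) * (h.choose j : ℕ)) r]
    push_cast
    rw [← Finset.sum_range_reflect]
    refine sum_congr rfl fun j hj => ?_
    have hj' := mem_range.1 hj
    rw [show r + 1 - 1 - j = r - j by omega, show r - (r - j) = j by omega]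
  rw [hV, Finset.sum_range_succ', Nat.choose_zero_right, Nat.sub_zero, Nat.cast_one, mul_one, add_sub_cancel_right]
  refine IsUltrametricDist.norm_sum_le_of_forall_le_of_nonneg (by positivity) fun j hj => ?_
  have hj' := mem_range.1 hj
  rw [cast_choose_succ_eq, norm_mul, norm_div, norm_mul]
  have h1 : ‖(((k + c).choose (r - (j + 1)) : ℕ) : ℚ_[p])‖ ≤ 1 := norm_natCast_le_one' _
  have h2 : ‖(((h - 1).choose j : ℕ) : ℚ_[p])‖ ≤ 1 := norm_natCast_le_one' _
  have h3 : ‖((j + 1 : ℕ) : ℚ_[p])‖⁻¹ ≤ (p : ℝ) ^ Nat.log p r := by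
    rw [← norm_inv]; exact norm_inv_natCast_le_pow_log (by omega) (by omega)
  have hj0 : 0 < ‖((j + 1 : ℕ) : ℚ_[p])‖ := norm_pos_iff.mpr (by exact_mod_cast Nat.succ_ne_zero j)
  rw [div_eq_mul_inv]
  calc ‖(((k + c).choose (r - (j + 1)) : ℕ) : ℚ_[p])‖ * (‖(h : ℚ_[p])‖ * ‖(((h - 1).choose j : ℕ) : ℚ_[p])‖ *
        ‖((j + 1 : ℕ) : ℚ_[p])‖⁻¹)
      ≤ 1 * (‖(h : ℚ_[p])‖ * 1 * (p : ℝ) ^ Nat.log p r) := by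
        gcongr
    _ = (p : ℝ) ^ Nat.log p r * ‖(h : ℚ_[p])‖ := by ring

/-! ## §3. Lemma 2.5 in Riemann-sum form: `‖p^{−n}Σ_{k<p^n} f(k)‖_p ≤ max(‖f(0)‖_p, p·M)` -/

/-- `‖p^n m‖_p ≤ p^{−n}`. [folklore] -/
private theorem norm_natCast_pow_mul_le' (n m : ℕ) : ‖((p ^ n * m : ℕ) : ℚ_[p])‖ ≤ (p : ℝ) ^ (-(n : ℤ)) := by
  push_cast
  rw [norm_mul, norm_pow, Padic.norm_p, zpow_neg, zpow_natCast, inv_pow]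
  exact mul_le_of_le_one_right (by positivity) (norm_natCast_le_one' m)

/-- The one-step estimate `‖S_{n+1}(f) − S_n(f)‖_p ≤ p·M` when `f|_ℕ` is Lipschitz with constant `M`
(Robert V.5.1 Prop. 1 (a); the tree's `volkenbornSum_succ_sub` sees only natural arguments).
[cite: LaiSprangZudilin2026, Lemma 2.5 (proof via [Lai2025], digit peeling)] -/
theorem norm_volkenbornSum_succ_sub_le_of_lipNat {M : ℝ} {f : ℤ_[p] → ℚ_[p]} (hM : 0 ≤ M)
    (hf : LipNat p M (fun k : ℕ => f k)) (n : ℕ) :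
    ‖volkenbornSum p f (n + 1) - volkenbornSum p f n‖ ≤ p * M := by
  have hp0 : (0 : ℝ) < p := by exact_mod_cast hp.out.pos
  rw [volkenbornSum_succ_sub, norm_smul, norm_inv, norm_pow, Padic.norm_p, inv_pow, inv_inv]
  have hsum : ‖∑ m ∈ range p, ∑ i ∈ range (p ^ n),
      (f ((p ^ n * m + i : ℕ) : ℤ_[p]) - f (i : ℤ_[p]))‖ ≤ M * (p : ℝ) ^ (-(n : ℤ)) := by
    refine IsUltrametricDist.norm_sum_le_of_forall_le_of_nonneg (by positivity) fun m _ => ?_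
    refine IsUltrametricDist.norm_sum_le_of_forall_le_of_nonneg (by positivity) fun i _ => ?_
    have h := hf i (p ^ n * m)
    rw [show p ^ n * m + i = i + p ^ n * m from Nat.add_comm _ _]
    exact h.trans (mul_le_mul_of_nonneg_left (norm_natCast_pow_mul_le' n m) hM)
  refine (mul_le_mul_of_nonneg_left hsum (by positivity)).trans (le_of_eq ?_)
  rw [zpow_neg, zpow_natCast, pow_succ]
  field_simp

/-- **Lemma 2.5 (Lipschitz form, every Riemann sum):** if `f|_ℕ` is Lipschitz with constant `M` then
`‖p^{−n}Σ_{k<p^n} f(k)‖_p ≤ max(‖f(0)‖_p, p·M)` for every `n` — i.e. `v_p(S_n(f)) ≥ min{v_p(f(0)), Δ₀(f) − 1}`,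
which is `≥ Δ(f) − 1` ("`v_p(∫_{ℤ_p} f(t)dt) ≥ Δ(f) − 1`"). [cite: LaiSprangZudilin2026, Lemma 2.5] -/
theorem norm_volkenbornSum_le_of_lipNat {M : ℝ} {f : ℤ_[p] → ℚ_[p]} (hM : 0 ≤ M)
    (hf : LipNat p M (fun k : ℕ => f k)) (n : ℕ) :
    ‖volkenbornSum p f n‖ ≤ max ‖f 0‖ (p * M) := by
  induction n with
  | zero => rw [volkenbornSum_zero]; exact le_max_left _ _
  | succ n ih =>
    have h : volkenbornSum p f (n + 1) =
        (volkenbornSum p f (n + 1) - volkenbornSum p f n) + volkenbornSum p f n := by abel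
    rw [h]
    refine (IsUltrametricDist.norm_add_le_max _ _).trans (max_le ?_ ih)
    exact (norm_volkenbornSum_succ_sub_le_of_lipNat hM hf n).trans (le_max_right _ _)

/-- **Lemma 2.5 (Lipschitz form, the integral):** the same bound for the limit of the Riemann sums, i.e. for
`∫_{ℤ_p} f(t)dt` whenever it exists. [cite: LaiSprangZudilin2026, Lemma 2.5] -/
theorem norm_le_of_tendsto_volkenbornSum_of_lipNat {M : ℝ} {f : ℤ_[p] → ℚ_[p]} (hM : 0 ≤ M)
    (hf : LipNat p M (fun k : ℕ => f k)) {I : ℚ_[p]} (hI : Tendsto (volkenbornSum p f) atTop (𝓝 I)) :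
    ‖I‖ ≤ max ‖f 0‖ (p * M) :=
  le_of_tendsto' hI.norm fun n => norm_volkenbornSum_le_of_lipNat hM hf n

/-! ## §4. Lemma 2.4: the translation formula `∫f(t+k)dt = ∫f(t)dt + Σ_{ℓ<k} f′(ℓ)` -/

/-- **Lemma 2.4 (one step):** if the Riemann sums of `f` tend to `I` and `p^{−n}(f(p^n + c) − f(c)) → D`
(the derivative of `f` at the natural number `c` along `p^n`), then the Riemann sums of `t ↦ f(t + c + 1)` tend to
those of `t ↦ f(t + c)` plus `D`: `∫f(t+c+1)dt = ∫f(t+c)dt + f′(c)`. [cite: LaiSprangZudilin2026, Lemma 2.4] -/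
theorem tendsto_volkenbornSum_shift_succ {f : ℤ_[p] → ℚ_[p]} {c : ℕ} {I D : ℚ_[p]}
    (hI : Tendsto (volkenbornSum p (fun t => f (t + c))) atTop (𝓝 I))
    (hD : Tendsto (fun n : ℕ => ((p : ℚ_[p]) ^ n)⁻¹ • (f (((p ^ n : ℕ) : ℤ_[p]) + c) - f (c : ℤ_[p])))
      atTop (𝓝 D)) :
    Tendsto (volkenbornSum p (fun t => f (t + (c + 1 : ℕ)))) atTop (𝓝 (I + D)) := by
  set g : ℤ_[p] → ℚ_[p] := fun t => f (t + c) with hg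
  have hD' : Tendsto (fun n : ℕ => ((p : ℚ_[p]) ^ n)⁻¹ • (g ((p ^ n : ℕ) : ℤ_[p]) - g 0)) atTop (𝓝 D) := by
    have e : ∀ n : ℕ, ((p : ℚ_[p]) ^ n)⁻¹ • (g ((p ^ n : ℕ) : ℤ_[p]) - g 0) =
        ((p : ℚ_[p]) ^ n)⁻¹ • (f (((p ^ n : ℕ) : ℤ_[p]) + c) - f (c : ℤ_[p])) := fun n => by
      rw [hg]; dsimp only; rw [zero_add]
    simp_rw [e]
    exact hD
  have h := hI.add (tendsto_volkenbornSum_fwdDiff hD')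
  have hfun : (fun t : ℤ_[p] => f (t + (c + 1 : ℕ))) = fun t => g t + (g (t + 1) - g t) := by
    funext t
    rw [add_sub_cancel, hg]
    dsimp only
    rw [Nat.cast_succ, add_assoc, add_comm (c : ℤ_[p]) 1]
  rw [hfun]
  refine h.congr fun n => ?_
  rw [← volkenbornSum_add]

/-- **Lemma 2.4:** `∫_{ℤ_p} f(t+k)dt = ∫_{ℤ_p} f(t)dt + Σ_{ℓ=0}^{k−1} f′(ℓ)` — for the Riemann sums: if `S_n(f) → I` and,
for every `ℓ < k`, `p^{−n}(f(p^n+ℓ) − f(ℓ)) → D(ℓ)`, then `S_n(f(·+k)) → I + Σ_{ℓ<k} D(ℓ)`.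
[cite: LaiSprangZudilin2026, Lemma 2.4] -/
theorem tendsto_volkenbornSum_shift_nat {f : ℤ_[p] → ℚ_[p]} {I : ℚ_[p]} {D : ℕ → ℚ_[p]} (k : ℕ)
    (hI : Tendsto (volkenbornSum p f) atTop (𝓝 I))
    (hD : ∀ ℓ < k, Tendsto (fun n : ℕ => ((p : ℚ_[p]) ^ n)⁻¹ • (f (((p ^ n : ℕ) : ℤ_[p]) + ℓ) - f (ℓ : ℤ_[p])))
      atTop (𝓝 (D ℓ))) :
    Tendsto (volkenbornSum p (fun t => f (t + k))) atTop (𝓝 (I + ∑ ℓ ∈ range k, D ℓ)) := by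
  induction k with
  | zero => simpa using hI
  | succ k ih =>
    have h1 := ih fun ℓ hℓ => hD ℓ (by omega)
    have h2 := tendsto_volkenbornSum_shift_succ h1 (hD k (by omega))
    rw [Finset.sum_range_succ, ← add_assoc]
    exact h2

/-- The derivative limit along `p^n` from a derivative in `ℚ_p`: if `g : ℚ_p → ℚ_p` has derivative `g′(x)` at `x`,
then `p^{−n}(g(x + p^n) − g(x)) → g′(x)` (the quantities `f′(ℓ)` of Lemma 2.4 as limits of the Riemann-sum telescopes).
[cite: LaiSprangZudilin2026, Lemma 2.4] -/
theorem tendsto_pow_inv_smul_sub_of_hasDerivAt {g : ℚ_[p] → ℚ_[p]} {x g' : ℚ_[p]} (hg : HasDerivAt g g' x) :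
    Tendsto (fun n : ℕ => ((p : ℚ_[p]) ^ n)⁻¹ • (g (x + (p : ℚ_[p]) ^ n) - g x)) atTop (𝓝 g') := by
  have h1 : Tendsto (fun n : ℕ => (p : ℚ_[p]) ^ n) atTop (𝓝[≠] 0) := by
    refine tendsto_nhdsWithin_iff.2 ⟨?_, Eventually.of_forall fun n => ?_⟩
    · exact tendsto_pow_atTop_nhds_zero_of_norm_lt_one
        (by rw [Padic.norm_p]; exact inv_lt_one_of_one_lt₀ (by exact_mod_cast hp.out.one_lt))
    · exact pow_ne_zero _ (by exact_mod_cast hp.out.ne_zero)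
  exact hg.tendsto_slope_zero.comp h1

/-! ## §5. Lemma 2.8: the half-shifted integrals `∫_{ℤ₂}(t+½)^{−m}dt = m·2^{m+1}·ζ₂(m+1)` -/

section TwoAdic

/-- `‖½‖₂ = 2 > 1` (so `(t+½)^{−m}` has no pole on `ℤ₂`). [cite: LaiSprangZudilin2026, Lemma 2.8] -/
theorem one_lt_norm_half : 1 < ‖(1 / 2 : ℚ_[2])‖ := by
  have h2 : ‖(2 : ℚ_[2])‖ = 2⁻¹ := by simpa using Padic.norm_p (p := 2)
  rw [one_div, norm_inv, h2]; norm_num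

/-- `‖a/4‖₂ = 4 = q₂` for odd `a` (the points `¼, ¾` of (2.1)). [cite: LaiSprangZudilin2026, §2.3 (2.1)] -/
theorem one_lt_norm_div_four {a : ℕ} (ha : ¬ 2 ∣ a) : 1 < ‖(a : ℚ_[2]) / 4‖ := by
  rw [show (4 : ℚ_[2]) = ((2 ^ (1 + 1) : ℕ) : ℚ_[2]) by norm_num, norm_natCast_div_pow ha 1]
  norm_num

/-- The Riemann sums of `(t + ½)^{−(k+1)}` converge `2`-adically (power-series integrability, tree
`tendsto_riemannSum_zpow_neg` at `x = ½`). [cite: LaiSprangZudilin2026, §2.2 ("every `f ∈ S¹` is Volkenborn integrable") and §3 (341)] -/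
theorem exists_tendsto_volkenbornSum_half_zpow_neg (k : ℕ) :
    ∃ V : ℚ_[2], Tendsto (volkenbornSum 2 (fun t : ℤ_[2] => ((t : ℚ_[2]) + 1 / 2) ^ (-((k : ℤ) + 1)))) atTop (𝓝 V) := by
  refine ⟨_, (tendsto_riemannSum_zpow_neg (p := 2) one_lt_norm_half k).congr fun r => ?_⟩
  rw [volkenbornSum_def, smul_eq_mul, ← zpow_natCast, ← zpow_neg]
  congr 1
  refine sum_congr rfl fun m _ => ?_
  rw [PadicInt.coe_natCast, add_comm]

/-- The limits `W_a = lim_N 2^{−N}Σ_{k<2^N}(a+4k)^{−(k'+1)}` (`a` odd) exist (tree `tendsto_riemannSum_zpow_neg` at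
`x = a/4`). [cite: LaiSprangZudilin2026, §2.3 (2.1)] -/
theorem exists_tendsto_volkenbornSum_unitClass_four {a : ℕ} (ha : ¬ 2 ∣ a) (k : ℕ) :
    ∃ W : ℚ_[2], Tendsto (volkenbornSum 2 (fun t : ℤ_[2] =>
      ((a : ℚ_[2]) + ((2 ^ (1 + 1) : ℕ) : ℚ_[2]) * (t : ℚ_[2])) ^ (-((k : ℤ) + 1)))) atTop (𝓝 W) := by
  have h4 : ((2 ^ (1 + 1) : ℕ) : ℚ_[2]) = 4 := by norm_num
  have h40 : (4 : ℚ_[2]) ≠ 0 := by norm_num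
  refine ⟨(4 : ℚ_[2]) ^ (-((k : ℤ) + 1)) * _,
    ((tendsto_riemannSum_zpow_neg (p := 2) (one_lt_norm_div_four ha) k).const_mul
      ((4 : ℚ_[2]) ^ (-((k : ℤ) + 1)))).congr fun r => ?_⟩
  rw [volkenbornSum_def, smul_eq_mul, ← zpow_natCast, ← zpow_neg, mul_left_comm]
  congr 1
  rw [mul_sum]
  refine sum_congr rfl fun m _ => ?_
  rw [PadicInt.coe_natCast, h4, ← mul_zpow]
  congr 1
  field_simp

/-- **Lemma 2.8** ("`(1/(s−1))∫_{ℤ₂}dt/(t+½)^{s−1} = 2^s·ζ₂(s)`", here `s = k+2`, `m = s−1 = k+1`): the Riemann sums of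
`(t+½)^{−(k+1)}` tend to `(k+1)·2^{k+2}·ζ₂(k+2)`, with `ζ₂` the tree's `padicZetaValue 2` — proof as printed: parity
split of the Riemann sum at level `N+1` into the unit classes `1 + 4t`, `3 + 4t`, and (2.1) in the form of the tree's
`padicZetaValue_eq_sum_unitClasses` (`q₂ = 4`). [cite: LaiSprangZudilin2026, Lemma 2.8 (with (2.1))] -/
theorem tendsto_volkenbornSum_half_zpow_neg (k : ℕ) :
    Tendsto (volkenbornSum 2 (fun t : ℤ_[2] => ((t : ℚ_[2]) + 1 / 2) ^ (-((k : ℤ) + 1)))) atTop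
      (𝓝 (((k : ℚ_[2]) + 1) * 2 ^ (k + 2) * padicZetaValue 2 (k + 2))) := by
  classical
  -- the limits on the two unit classes modulo 4
  have hW : ∀ a ∈ (range (2 ^ (1 + 1))).filter (fun a => ¬ 2 ∣ a), ∃ W : ℚ_[2],
      Tendsto (volkenbornSum 2 (fun t : ℤ_[2] =>
        ((a : ℚ_[2]) + ((2 ^ (1 + 1) : ℕ) : ℚ_[2]) * (t : ℚ_[2])) ^ (-((k : ℤ) + 1)))) atTop (𝓝 W) :=
    fun a ha => exists_tendsto_volkenbornSum_unitClass_four (mem_filter.1 ha).2 k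
  choose! W hW using hW
  have hexp : (-(((k + 2) - 1 : ℕ) : ℤ)) = -((k : ℤ) + 1) := by omega
  have hζ := padicZetaValue_eq_sum_unitClasses (p := 2) (j := k + 2) (by omega) 1 (W := W)
    (fun a ha => by rw [hexp]; exact hW a ha)
  -- the set of odd residues modulo 4
  have hU : (range (2 ^ (1 + 1))).filter (fun a => ¬ 2 ∣ a) = {1, 3} := by decide
  rw [hU, Finset.sum_pair (by norm_num)] at hζ
  have hW1 := hW 1 (by rw [hU]; simp)
  have hW3 := hW 3 (by rw [hU]; simp)
  -- parity split of the Riemann sum at level `N + 1`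
  set g : ℤ_[2] → ℚ_[2] := fun t => ((t : ℚ_[2]) + 1 / 2) ^ (-((k : ℤ) + 1)) with hg
  have h4 : ((2 ^ (1 + 1) : ℕ) : ℚ_[2]) = 4 := by norm_num
  have hcl : ∀ (a : ℕ) (t : ℤ_[2]), g ((a : ℤ_[2]) + ((2 ^ 1 : ℕ) : ℤ_[2]) * t) =
      (2 : ℚ_[2]) ^ ((k : ℤ) + 1) * (((2 * a + 1 : ℕ) : ℚ_[2]) + ((2 ^ (1 + 1) : ℕ) : ℚ_[2]) * (t : ℚ_[2])) ^ (-((k : ℤ) + 1)) := by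
    intro a t
    have e : ((((a : ℤ_[2]) + ((2 ^ 1 : ℕ) : ℤ_[2]) * t : ℤ_[2]) : ℚ_[2]) + 1 / 2) =
        (2 : ℚ_[2])⁻¹ * (((2 * a + 1 : ℕ) : ℚ_[2]) + ((2 ^ (1 + 1) : ℕ) : ℚ_[2]) * (t : ℚ_[2])) := by
      simp only [PadicInt.coe_add, PadicInt.coe_mul, PadicInt.coe_natCast]
      push_cast
      field_simp
      ring
    rw [hg]
    dsimp only
    rw [e, mul_zpow, inv_zpow', neg_neg]
  have hsplit : ∀ N : ℕ, volkenbornSum 2 g (N + 1) =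
      (2 : ℚ_[2])⁻¹ * (2 : ℚ_[2]) ^ ((k : ℤ) + 1) *
        (volkenbornSum 2 (fun t : ℤ_[2] => ((1 : ℕ) + ((2 ^ (1 + 1) : ℕ) : ℚ_[2]) * (t : ℚ_[2])) ^ (-((k : ℤ) + 1))) N +
         volkenbornSum 2 (fun t : ℤ_[2] => ((3 : ℕ) + ((2 ^ (1 + 1) : ℕ) : ℚ_[2]) * (t : ℚ_[2])) ^ (-((k : ℤ) + 1))) N) := by
    intro N
    have h0 : volkenbornSum 2 (fun t : ℤ_[2] => g (((0 : ℕ) : ℤ_[2]) + ((2 ^ 1 : ℕ) : ℤ_[2]) * t)) N =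
        (2 : ℚ_[2]) ^ ((k : ℤ) + 1) *
          volkenbornSum 2 (fun t : ℤ_[2] => ((1 : ℕ) + ((2 ^ (1 + 1) : ℕ) : ℚ_[2]) * (t : ℚ_[2])) ^ (-((k : ℤ) + 1))) N := by
      rw [← smul_eq_mul, ← volkenbornSum_smul]
      congr 1
      funext t
      rw [hcl 0 t, smul_eq_mul]
    have h1 : volkenbornSum 2 (fun t : ℤ_[2] => g (((1 : ℕ) : ℤ_[2]) + ((2 ^ 1 : ℕ) : ℤ_[2]) * t)) N =
        (2 : ℚ_[2]) ^ ((k : ℤ) + 1) *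
          volkenbornSum 2 (fun t : ℤ_[2] => ((3 : ℕ) + ((2 ^ (1 + 1) : ℕ) : ℚ_[2]) * (t : ℚ_[2])) ^ (-((k : ℤ) + 1))) N := by
      rw [← smul_eq_mul, ← volkenbornSum_smul]
      congr 1
      funext t
      rw [hcl 1 t, smul_eq_mul]
    rw [volkenbornSum_add_eq_sum_residues g N 1, show range (2 ^ 1) = range (0 + 1 + 1) from rfl,
      Finset.sum_range_succ, Finset.sum_range_succ, Finset.sum_range_zero, zero_add, h0, h1, smul_eq_mul, pow_one]
    push_cast
    ring
  -- the limit along `N + 1`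
  have hlim : Tendsto (fun N => volkenbornSum 2 g (N + 1)) atTop
      (𝓝 ((2 : ℚ_[2])⁻¹ * (2 : ℚ_[2]) ^ ((k : ℤ) + 1) * (W 1 + W 3))) := by
    simp_rw [hsplit]
    exact ((hW1.add hW3).const_mul _)
  have hval : (2 : ℚ_[2])⁻¹ * (2 : ℚ_[2]) ^ ((k : ℤ) + 1) * (W 1 + W 3) =
      ((k : ℚ_[2]) + 1) * 2 ^ (k + 2) * padicZetaValue 2 (k + 2) := by
    rw [hζ, h4]
    have hk1 : (((k + 2 : ℕ) : ℚ_[2]) - 1) = (k : ℚ_[2]) + 1 := by push_cast; ring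
    rw [hk1]
    have hk0 : ((k : ℚ_[2]) + 1) ≠ 0 := by exact_mod_cast (Nat.cast_add_one_ne_zero k : ((k : ℚ_[2]) + 1) ≠ 0)
    rw [zpow_add_one₀ (two_ne_zero), zpow_natCast]
    field_simp
    ring
  rw [← hval]
  exact (tendsto_add_atTop_iff_nat 1).1 hlim

/-- **Lemma 2.8 for the translates** (`(341)–(342)` of §3): for `c ∈ ℕ`, the Riemann sums of `(t+c+½)^{−(k+1)}` tend
to `(k+1)2^{k+2}ζ₂(k+2) − (k+1)Σ_{ℓ<c}(ℓ+½)^{−(k+2)}` — Lemma 2.4 with `f(t) = (t+½)^{−(k+1)}`,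
`f′(ℓ) = −(k+1)(ℓ+½)^{−(k+2)}`. [cite: LaiSprangZudilin2026, Lemma 3.3 (proof, display (342))] -/
theorem tendsto_volkenbornSum_half_shift_zpow_neg (k c : ℕ) :
    Tendsto (volkenbornSum 2 (fun t : ℤ_[2] => ((t : ℚ_[2]) + c + 1 / 2) ^ (-((k : ℤ) + 1)))) atTop
      (𝓝 (((k : ℚ_[2]) + 1) * 2 ^ (k + 2) * padicZetaValue 2 (k + 2) +
        ∑ ℓ ∈ range c, -((k : ℚ_[2]) + 1) * (((ℓ : ℚ_[2]) + 1 / 2) ^ (k + 2))⁻¹)) := by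
  set f : ℤ_[2] → ℚ_[2] := fun t => ((t : ℚ_[2]) + 1 / 2) ^ (-((k : ℤ) + 1)) with hf
  have hI := tendsto_volkenbornSum_half_zpow_neg k
  have h := tendsto_volkenbornSum_shift_nat (p := 2) (f := f)
    (D := fun ℓ => -((k : ℚ_[2]) + 1) * (((ℓ : ℚ_[2]) + 1 / 2) ^ (k + 2))⁻¹) c hI ?_
  · have hfun : (fun t : ℤ_[2] => f (t + (c : ℤ_[2]))) = fun t : ℤ_[2] => ((t : ℚ_[2]) + c + 1 / 2) ^ (-((k : ℤ) + 1)) := by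
      funext t
      simp only [hf, PadicInt.coe_add, PadicInt.coe_natCast]
    rw [hfun] at h
    exact h
  intro ℓ _
  -- the derivative of `x ↦ x^{−(k+1)}` at `x₀ = ℓ + ½`, along `x₀ + 2^n`
  have hx₀0 : ((ℓ : ℚ_[2]) + 1 / 2) ≠ 0 := by
    have h1 : 1 < ‖(ℓ : ℚ_[2]) + 1 / 2‖ := by
      rw [add_comm]
      have h2 := one_lt_norm_half
      have hm := norm_natCast_le_one' (p := 2) ℓ
      have hne : ‖(1 / 2 : ℚ_[2])‖ ≠ ‖(ℓ : ℚ_[2])‖ := ne_of_gt (hm.trans_lt h2)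
      rw [Padic.add_eq_max_of_ne hne, max_eq_left (hm.trans h2.le)]
      exact h2
    intro h0; rw [h0, norm_zero] at h1; exact absurd h1 (by norm_num)
  have hderiv : HasDerivAt (fun x : ℚ_[2] => x ^ (-((k : ℤ) + 1)))
      ((((-((k : ℤ) + 1) : ℤ)) : ℚ_[2]) * ((ℓ : ℚ_[2]) + 1 / 2) ^ ((-((k : ℤ) + 1)) - 1)) ((ℓ : ℚ_[2]) + 1 / 2) :=
    hasDerivAt_zpow (-((k : ℤ) + 1)) _ (Or.inl hx₀0)
  have hlim := tendsto_pow_inv_smul_sub_of_hasDerivAt (p := 2) hderiv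
  have hval : (((-((k : ℤ) + 1) : ℤ)) : ℚ_[2]) * ((ℓ : ℚ_[2]) + 1 / 2) ^ ((-((k : ℤ) + 1)) - 1) =
      -((k : ℚ_[2]) + 1) * (((ℓ : ℚ_[2]) + 1 / 2) ^ (k + 2))⁻¹ := by
    rw [show (-((k : ℤ) + 1)) - 1 = -((k + 2 : ℕ) : ℤ) by push_cast; ring, zpow_neg, zpow_natCast]
    push_cast
    ring
  rw [hval] at hlim
  refine hlim.congr fun n => ?_
  simp only [hf, PadicInt.coe_add, PadicInt.coe_natCast]
  push_cast
  ring_nf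

end TwoAdic

end Literature.NumberTheory.Irrationality.PAdicZetaValues
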